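import Mathlib
import Summits.NavierStokesRegularity.NavierStokesRegularity.Theorems.EulerZoomLiouvillePowerGaugeEulerLiouvilleSelfSimilarTopBadNode
import Summits.NavierStokesRegularity.NavierStokesRegularity.Theorems.EulerZoomLiouvillePowerGaugeEulerLiouvilleSelfSimilarTopBadNodeThin
import HarnessLib.Audit

/-!
# Rung C1 of the crux `EulerZoomLiouville.PowerGaugeEulerLiouville`: a HYPERBOLIC top bad node is
# impossible — an in-window profile all of whose bad non-vortical nodes are nondegenerate is trivial

Route №10 `EulerZoomLiouville` (NavierStokesRegularity), crux E = stmt-NavierStokesRegularity-19832,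
tenure rung C1 (exactly self-similar members), registered residue `stub_selfSimilarExtremal`.
Fifth file of the NODAL-CONTINUUM line (lineage ns-typeII-p1, gen 7).  Setting: `0 < γ < ½`, a `C²`
stationary self-similar Euler profile `(U, P)` (CIV 2026 (3.3)) with the far field (3.8), `V = γ(y−c)+U`,
`Ω = curl U`, `𝒩_V = {V = 0}`, `ℋ` the Bernoulli function (3.30), `O = {Ω ≠ 0}` the vortical region.
NO HYPOTHESIS ON THE SIZE OR STRUCTURE OF THE NODAL SET.

By `exists_topBadNode` (`…SelfSimilarTopBadNode`), if `Ω ≢ 0` there is a non-vortical bad node `z♭`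
adherent to `O` with `O ⊆ {ℋ < ℋ(z♭)}`; `A = DV(z♭) = γI + DU(z♭)` is symmetric with top eigenvalue
`≥ 1 + γ`.  This file runs the LOCAL EXIT ANALYSIS at `z♭` when `A` is NONDEGENERATE:

* `false_of_topBadNode_of_injective` — **core.**  In an orthonormal eigenbasis of `A` split
  `ζ = Y − z♭` into the components `p = Σ_{a_i>0} ζ_i²` (backward-contracting = `Hess ℋ`-negative
  directions, `Hess ℋ(z♭) = (2γ−1)A`) and `m = Σ_{a_i<0} ζ_i²`.  By `exists_thinRadius_of_badNode`
  (`…SelfSimilarTopBadNodeThin`) there is a vortical point `x` within `ε` of `z♭` whose backward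
  trajectory `Y` leaves `B̄(z♭, r)`; up to its first exit time, `p' ≤ −μp + ρ²r²/μ`
  (`sum_coord_velocity_le`, `|E| ≤ ρ|ζ|`), so `p ≤ ε² + 2ρ²r²/μ² ≤ θ₀r²` by a barrier, hence at exit
  `m ≥ (1−θ₀)r²` and the second-order expansion (`selfSimilarBernoulli_expansion_of_curl_eq_zero`)
  gives `ℋ(Y(t₁)) ≥ ℋ(z♭) + (1−2γ)μr²/8 > ℋ(z♭)` — but `Y(t₁) ∈ O ⊆ {ℋ < ℋ(z♭)}` (flow invariance):
  contradiction;
* `eq_zero_of_badNodes_nondegenerate` — **THEOREM: if `DV(z)` is injective at every NON-VORTICAL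
  stagnation point `z` carrying a stretching rate `≥ 1`, then `U ≡ 0`** (arbitrary nodal set);
* `exists_degenerate_topBadNode_of_ne_zero` — **SURVIVOR PORTRAIT: a nontrivial classical in-window
  profile has a stagnation point `z♭` with `Ω(z♭) = 0`, a unit `w` with `⟪DU(z♭)w, w⟫ ≥ 1`, a vector
  `v ≠ 0` with `DU(z♭)v = −γv` (so `spec DU(z♭) = {s, −γ, γ−s}`, `s ≥ 1`), `z♭ ∈ closure{Ω ≠ 0}` and
  `{Ω ≠ 0} ⊆ {ℋ < ℋ(z♭)}`** — the degenerate, resonant configuration of a stagnation CURVE/circle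
  through a strongly strained non-vortical point (e.g. the stagnation circles of axisymmetric profiles,
  CIV §4); `…_of_exponent` is the route form `γ = 1/(2+ρ)`.

Together with the nodal-countability exclusion (`eq_zero_of_countable_nodalSet`, lineage ns-typeII-p2)
the classical portrait of rung C1 is now: uncountable nodal set AND a degenerate non-vortical bad node at
the top bad Bernoulli level on `∂{Ω ≠ 0}`.

WHAT THIS IS NOT: not NS, not E, not rung C1 — classical (`C²`) profiles with (3.8); the degenerate
case (`−γ ∈ spec DU(z♭)`) is untouched; the weak class is untouched.
References: P. Constantin, M. Ignatova, V. Vicol, arXiv:2602.17570 (2026), §3.4.3 (3.29)–(3.33), §3.5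
Thms 3.8–3.10, §4. [ConstantinIgnatovaVicol2026Putative]; A. Katok, B. Hasselblatt, *Introduction to the
Modern Theory of Dynamical Systems* (1995), §6.2. [KatokHasselblatt1995]
-/

noncomputable section

-- flat `Theorems/<Route><Decl>…` files of one crux share the namespace of the crux (tree convention)
set_option linter.dupNamespace false

open Set Filter Topology Metric Function InnerProductSpace
open scoped RealInnerProductSpace NNReal

namespace Summit.NavierStokesRegularity.NavierStokesRegularity.Theorems.PowerGaugeEulerLiouville.NodalContinuum

open Literature.Analysis Literature.Analysis.FluidPDE Literature.Analysis.ODE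
open Summit.NavierStokesRegularity.NavierStokesRegularity.Theorems.PowerGaugeEulerLiouville.NodalFiniteness

variable {γ C : ℝ} {c : EuclideanSpace ℝ (Fin 3)}
  {U : EuclideanSpace ℝ (Fin 3) → EuclideanSpace ℝ (Fin 3)} {P : EuclideanSpace ℝ (Fin 3) → ℝ}

/-- **Core: a hyperbolic top bad node is impossible.**  Let `0 < γ < ½`, `(U, P)` a `C²` self-similar
Euler profile with (3.8), and `z` a stagnation point with `curl U(z) = 0`, carrying a unit `w` with
`⟪DU(z)w, w⟫ ≥ 1`, adherent to the vortical region `O = {curl U ≠ 0}`, with `O ⊆ {ℋ < ℋ(z)}`.  If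
`DV(z) = γI + DU(z)` is injective, contradiction.  (Exit analysis in the eigen-coordinates of the
symmetric `DV(z)`: the THIN alternative of `certificate_of_curl_eq_zero` gives a non-trapped vortical
point near `z` — the KILL alternative being refuted by the top eigenvalue `≥ 1+γ` —; along its backward
trajectory the backward-contracting components stay `≤ θ₀r²` up to the first exit from `B̄(z, r)`
(barrier for `p' ≤ −μp + ρ²r²/μ`), so at exit the second-order expansion of `ℋ` is positive,
contradicting `ℋ < ℋ(z)` on `O`.)
[cite: ConstantinIgnatovaVicol2026Putative, §3.4.3–§3.5 (Bernoulli landscape; local analysis not in print)] [cite: KatokHasselblatt1995, §6.2 (cone criterion)] -/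
theorem false_of_topBadNode_of_injective (h : IsSelfSimilarEulerProfile γ c U P) (hγ : 0 < γ)
    (hγ2 : γ < 1 / 2) (hfar : HasSelfSimilarFarFieldWith γ c C U) {z : EuclideanSpace ℝ (Fin 3)}
    (hz : z ∈ selfSimilarNodalSet γ c U) (hΩz : curl U z = 0)
    (hbad : ∃ w : EuclideanSpace ℝ (Fin 3), ‖w‖ = 1 ∧ 1 ≤ ⟪fderiv ℝ U z w, w⟫)
    (hcl : z ∈ closure {y | curl U y ≠ 0})
    (hconf : ∀ x, curl U x ≠ 0 → selfSimilarBernoulli γ c U P x < selfSimilarBernoulli γ c U P z)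
    (hinj : ∀ v, fderiv ℝ (selfSimilarTransport γ c U) z v = 0 → v = 0) : False := by
  classical
  set V := selfSimilarTransport γ c U with hV
  set A : EuclideanSpace ℝ (Fin 3) →L[ℝ] EuclideanSpace ℝ (Fin 3) := fderiv ℝ V z with hAdef
  set Hb := selfSimilarBernoulli γ c U P with hHb
  have hK := lipschitzWith_transport h hγ hfar
  have hUd := h.differentiable_velocity
  have hVz : V z = 0 := hz
  have hDV : A = γ • ContinuousLinearMap.id ℝ _ + fderiv ℝ U z := fderiv_transport_eq h z
  have hSU := isSymmetric_fderiv_of_curl_eq_zero (hUd z) hΩz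
  have hA : (A : EuclideanSpace ℝ (Fin 3) →ₗ[ℝ] EuclideanSpace ℝ (Fin 3)).IsSymmetric := by
    rw [hDV]
    intro x y
    have hSxy := hSU x y
    simp only [ContinuousLinearMap.coe_coe] at hSxy
    simp only [ContinuousLinearMap.coe_coe, add_apply,
      FunLike.coe_smul, Pi.smul_apply, ContinuousLinearMap.id_apply,
      inner_add_left, inner_add_right, real_inner_smul_left, real_inner_smul_right]
    rw [hSxy]
  /- ── eigenbasis, eigenvalues, spectral constants `μ ≤ |a i| ≤ α` ── -/
  have hn : Module.finrank ℝ (EuclideanSpace ℝ (Fin 3)) = 3 := by simp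
  set b := hA.eigenvectorBasis hn with hbdef
  set a : Fin 3 → ℝ := hA.eigenvalues hn with hadef
  have hb : ∀ i, A (b i) = a i • b i := fun i => hA.apply_eigenvectorBasis hn i
  have ha0 : ∀ i, a i ≠ 0 := by
    intro i hai
    have h1 := hb i
    rw [hai, zero_smul] at h1
    have h2 := hinj _ h1
    have h3 : ‖b i‖ = 1 := b.orthonormal.1 i
    rw [h2, norm_zero] at h3
    exact zero_ne_one h3
  obtain ⟨i₀, -, hi₀⟩ := Finset.exists_min_image Finset.univ (fun i => |a i|) Finset.univ_nonempty
  obtain ⟨i₁, -, hi₁⟩ := Finset.exists_max_image Finset.univ (fun i => |a i|) Finset.univ_nonempty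
  set μ : ℝ := |a i₀| with hμdef
  set α : ℝ := |a i₁| with hαdef
  have hμpos : 0 < μ := abs_pos.2 (ha0 i₀)
  have hμle : ∀ i, μ ≤ |a i| := fun i => hi₀ i (Finset.mem_univ _)
  have hαge : ∀ i, a i ≤ α := fun i => (le_abs_self _).trans (hi₁ i (Finset.mem_univ _))
  have hμα : μ ≤ α := (hμle i₁)
  have hαpos : 0 < α := lt_of_lt_of_le hμpos hμα
  have hpos_i : ∀ i, 0 < a i → μ ≤ a i := fun i hi => by
    have := hμle i; rwa [abs_of_pos hi] at this
  have hneg_i : ∀ i, ¬ 0 < a i → a i ≤ -μ := fun i hi => by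
    have hlt : a i < 0 := lt_of_le_of_ne (not_lt.1 hi) (ha0 i)
    have := hμle i; rw [abs_of_neg hlt] at this; linarith
  /- ── the THIN radius `δ₀` ── -/
  obtain ⟨δ₀, hδ₀, hthin⟩ := exists_thinRadius_of_badNode h hγ2 hK hΩz hbad
  /- ── constants ── -/
  set θ₀ : ℝ := μ / (2 * (μ + α)) with hθ₀
  have hθ₀pos : 0 < θ₀ := by positivity
  have hθ₀le : θ₀ ≤ 1 / 2 := by
    rw [hθ₀, div_le_iff₀ (by positivity)]; linarith only [hαpos]
  have hθ₀key : (μ + α) * θ₀ = μ / 2 := by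
    rw [hθ₀]; field_simp
  set ν : ℝ := (1 - 2 * γ) * μ / 8 with hν
  have h12 : 0 < 1 - 2 * γ := by linarith
  have hνpos : 0 < ν := by positivity
  obtain ⟨δ₁, hδ₁, hexp⟩ := selfSimilarBernoulli_expansion_of_curl_eq_zero h hz hΩz hνpos
  set ρ : ℝ := μ * θ₀ / 2 with hρ
  have hρpos : 0 < ρ := by positivity
  obtain ⟨δ₂, hδ₂, hlin⟩ := exists_ball_linearisation h z hρpos
  set r : ℝ := min δ₀ (min δ₁ δ₂) / 2 with hr
  have hmpos : 0 < min δ₀ (min δ₁ δ₂) := lt_min hδ₀ (lt_min hδ₁ hδ₂)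
  have hrpos : 0 < r := by positivity
  have hrδ₀ : r < δ₀ := by
    have : min δ₀ (min δ₁ δ₂) ≤ δ₀ := min_le_left _ _
    rw [hr]; linarith only [this, hmpos]
  have hrδ₁ : r ≤ δ₁ := by
    have : min δ₀ (min δ₁ δ₂) ≤ δ₁ := (min_le_right _ _).trans (min_le_left _ _)
    rw [hr]; linarith only [this, hmpos]
  have hrδ₂ : r ≤ δ₂ := by
    have : min δ₀ (min δ₁ δ₂) ≤ δ₂ := (min_le_right _ _).trans (min_le_right _ _)
    rw [hr]; linarith only [this, hmpos]
  set ε : ℝ := r * θ₀ / 2 with hε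
  have hεpos : 0 < ε := by positivity
  have hεr : ε < r := by
    have h1 : r * θ₀ ≤ r * (1 / 2) := mul_le_mul_of_nonneg_left hθ₀le hrpos.le
    rw [hε]; linarith only [h1, hrpos]
  /- ── a vortical point near `z` whose backward trajectory leaves `B̄(z, r)` ── -/
  set O : Set (EuclideanSpace ℝ (Fin 3)) := {y | curl U y ≠ 0} with hO
  have hOo : IsOpen O := isOpen_vorticalSet h
  obtain ⟨x, hxO, hxε, t₀, ht₀, hout⟩ : ∃ x, curl U x ≠ 0 ∧ dist x z < ε ∧
      ∃ t₀, 0 ≤ t₀ ∧ r < ‖lipschitzFlow hK x (-t₀) - z‖ := by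
    by_contra hnone
    push Not at hnone
    -- then `ball z ε ∩ O` is trapped in `B̄(z, r) ⊆ B̄(z, δ₀)`: nonempty open, contradiction
    have hsub : ball z ε ∩ O ⊆ {x : EuclideanSpace ℝ (Fin 3) |
        ∀ t, 0 ≤ t → lipschitzFlow hK x (-t) ∈ closedBall z δ₀} := by
      rintro x ⟨hxball, hxO⟩ t ht
      have := hnone x hxO (mem_ball.1 hxball) t ht
      rw [mem_closedBall, dist_eq_norm]
      linarith only [this, hrδ₀]
    have hne : (ball z ε ∩ O).Nonempty := (mem_closure_iff_nhds.1 hcl) _ (ball_mem_nhds z hεpos)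
    obtain ⟨x, hx⟩ := hne
    have hxint : x ∈ interior {x : EuclideanSpace ℝ (Fin 3) |
        ∀ t, 0 ≤ t → lipschitzFlow hK x (-t) ∈ closedBall z δ₀} :=
      mem_interior.2 ⟨ball z ε ∩ O, hsub, isOpen_ball.inter hOo, hx⟩
    rw [hthin] at hxint
    exact hxint
  /- ── the backward trajectory and its first exit time ── -/
  set Y : ℝ → EuclideanSpace ℝ (Fin 3) := fun t => lipschitzFlow hK x (-t) with hYdef
  have hY : ∀ t, HasDerivAt Y ((-1 : ℝ) • V (Y t)) t := hasDerivAt_backwardFlow hK x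
  have hY0 : Y 0 = x := by simp [hYdef]
  have hYc : Continuous Y := continuous_iff_continuousAt.2 fun t => (hY t).continuousAt
  obtain ⟨Bd, hBd⟩ := backward_orbit_bounded hγ hfar hY
  have h0r : ‖Y 0 - z‖ < r := by rw [hY0, ← dist_eq_norm]; exact hxε.trans hεr
  obtain ⟨t₁, ht₁pos, -, hexit, hin, -⟩ := exists_firstExit hYc h0r ht₀ hout
  -- the exit point is vortical, hence strictly below `ℋ z`
  have hYt₁O : curl U (Y t₁) ≠ 0 := by
    intro h0
    have := curl_comp_eq_zero_of_curl_comp_eq_zero h hY hBd ht₁pos.le h0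
    rw [hY0] at this
    exact hxO this
  have hHlt : Hb (Y t₁) < Hb z := hconf _ hYt₁O
  /- ── eigen-coordinates: the backward-contracting part `p` ── -/
  set ζ : ℝ → EuclideanSpace ℝ (Fin 3) := fun t => Y t - z with hζdef
  set Ip : Finset (Fin 3) := Finset.univ.filter (fun i => 0 < a i) with hIp
  set p : ℝ → ℝ := fun t => ∑ i ∈ Ip, ⟪b i, ζ t⟫ ^ 2 with hpdef
  set p' : ℝ → ℝ := fun t => ∑ i ∈ Ip, 2 * ⟪b i, ζ t⟫ * ⟪b i, (-1 : ℝ) • V (Y t)⟫ with hp'def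
  have hζ' : ∀ t, HasDerivAt ζ ((-1 : ℝ) • V (Y t)) t := fun t => (hY t).sub_const z
  have hcoord : ∀ i t, HasDerivAt (fun s => ⟪b i, ζ s⟫) ⟪b i, (-1 : ℝ) • V (Y t)⟫ t := by
    intro i t
    have := (hasDerivAt_const t (b i)).inner ℝ (hζ' t)
    simpa using this
  have hp' : ∀ t, HasDerivAt p (p' t) t := by
    intro t
    simp only [hpdef, hp'def]
    refine HasDerivAt.fun_sum fun i _ => ?_
    have := (hcoord i t).mul (hcoord i t)
    simp only [← sq] at this
    refine this.congr_deriv ?_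
    ring
  -- the differential inequality `p' ≤ -μ p + ρ² r² / μ` inside the ball
  have hineq : ∀ t ∈ Icc 0 t₁, p' t ≤ -μ * p t + ρ ^ 2 * r ^ 2 / μ := by
    intro t ht
    set Ev := V (Y t) - A (ζ t) with hEv
    have hmem : Y t ∈ closedBall z δ₂ := by
      rw [mem_closedBall, dist_eq_norm]; exact (hin t ht).trans hrδ₂
    have hEvn : ‖Ev‖ ≤ ρ * r := by
      have := hlin (Y t) hmem z (mem_closedBall_self hδ₂.le)
      rw [← hV, ← hAdef, hVz, sub_zero] at this
      exact this.trans (mul_le_mul_of_nonneg_left (hin t ht) hρpos.le)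
    have hvel : (-1 : ℝ) • V (Y t) = -(A (ζ t)) - Ev := by
      rw [hEv, neg_one_smul]; abel
    have hIp' : ∀ i ∈ Ip, μ ≤ a i := by
      intro i hi
      rw [hIp, Finset.mem_filter] at hi
      exact hpos_i i hi.2
    have h1 := sum_coord_velocity_le hA b hb hμpos Ip hIp' (ζ t) Ev
    rw [← hvel] at h1
    have h2 : ‖Ev‖ ^ 2 / μ ≤ ρ ^ 2 * r ^ 2 / μ := by
      refine div_le_div_of_nonneg_right ?_ hμpos.le
      have := pow_le_pow_left₀ (norm_nonneg _) hEvn 2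
      linarith [show (ρ * r) ^ 2 = ρ ^ 2 * r ^ 2 by ring]
    show p' t ≤ -μ * p t + ρ ^ 2 * r ^ 2 / μ
    simp only [hp'def, hpdef]
    linarith only [h1, h2]
  -- barrier: `p ≤ M := ε² + 2ρ²r²/μ²` on `[0, t₁]`
  set M : ℝ := ε ^ 2 + 2 * ρ ^ 2 * r ^ 2 / μ ^ 2 with hM
  have hp0 : p 0 ≤ M := by
    have h1 : p 0 ≤ ‖ζ 0‖ ^ 2 := sum_sq_inner_filter_le b Ip (ζ 0)
    have h2 : ‖ζ 0‖ ^ 2 ≤ ε ^ 2 := by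
      have : ‖ζ 0‖ < ε := by
        simp only [hζdef, hY0, ← dist_eq_norm]; exact hxε
      exact pow_le_pow_left₀ (norm_nonneg _) this.le 2
    have h3 : 0 ≤ 2 * ρ ^ 2 * r ^ 2 / μ ^ 2 := by positivity
    rw [hM]
    linarith only [h1, h2, h3]
  have hpM : ∀ t ∈ Icc 0 t₁, p t ≤ M := by
    intro t ht
    refine image_le_of_deriv_right_lt_deriv_boundary' (f := p) (f' := p') (a := 0) (b := t₁)
      (fun s _ => (hp' s).continuousAt.continuousWithinAt)
      (fun s _ => (hp' s).hasDerivWithinAt) hp0 continuousOn_const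
      (fun s _ => hasDerivWithinAt_const _ _ _) ?_ ht
    intro s hs hps
    have h1 := hineq s ⟨hs.1, hs.2.le⟩
    rw [hps] at h1
    have h2 : -μ * M + ρ ^ 2 * r ^ 2 / μ = -(μ * ε ^ 2) - ρ ^ 2 * r ^ 2 / μ := by
      rw [hM]; field_simp; ring
    have h3 : 0 < μ * ε ^ 2 := by positivity
    have h4 : 0 ≤ ρ ^ 2 * r ^ 2 / μ := by positivity
    linarith only [h1, h2, h3, h4]
  have hMθ : M ≤ θ₀ * r ^ 2 := by
    have e1 : ε ^ 2 = θ₀ ^ 2 * r ^ 2 / 4 := by rw [hε]; ring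
    have e2 : 2 * ρ ^ 2 * r ^ 2 / μ ^ 2 = θ₀ ^ 2 * r ^ 2 / 2 := by
      rw [hρ]; field_simp
    have hθ1 : θ₀ ^ 2 ≤ θ₀ := by
      have : θ₀ * θ₀ ≤ θ₀ * 1 := mul_le_mul_of_nonneg_left (by linarith only [hθ₀le]) hθ₀pos.le
      nlinarith only [this]
    have hθr : θ₀ ^ 2 * r ^ 2 ≤ θ₀ * r ^ 2 := mul_le_mul_of_nonneg_right hθ1 (sq_nonneg r)
    have hx : 0 ≤ θ₀ ^ 2 * r ^ 2 := by positivity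
    rw [hM, e1, e2]
    linarith only [hθr, hx]
  /- ── at the exit point: `p ≤ θ₀ r²`, `m ≥ (1-θ₀) r²`, and `ℋ` is too large ── -/
  have hpt₁ : p t₁ ≤ θ₀ * r ^ 2 := (hpM t₁ ⟨ht₁pos.le, le_rfl⟩).trans hMθ
  set m₁ : ℝ := ∑ i ∈ Finset.univ.filter (fun i => ¬ 0 < a i), ⟪b i, ζ t₁⟫ ^ 2 with hm₁
  have hpm : p t₁ + m₁ = r ^ 2 := by
    have := sum_sq_inner_filter_add b (fun i => 0 < a i) (ζ t₁)
    rw [hexit] at this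
    exact this
  have hAζ : ⟪A (ζ t₁), ζ t₁⟫ ≤ α * p t₁ - μ * m₁ :=
    inner_apply_self_le_of_eigen hA b hb hαge hneg_i (ζ t₁)
  have hH := hexp (ζ t₁) (by rw [hexit]; exact hrδ₁)
  have hzζ : z + ζ t₁ = Y t₁ := by simp [hζdef]
  rw [hzζ, hexit] at hH
  -- `(2γ-1) ⟪Aζ,ζ⟫ ≥ (1-2γ)(μ m₁ - α p) ≥ (1-2γ) μ r² / 2`
  have hlin1 : μ / 2 * r ^ 2 ≤ μ * m₁ - α * p t₁ := by
    have hA1 : (μ + α) * p t₁ ≤ (μ + α) * (θ₀ * r ^ 2) :=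
      mul_le_mul_of_nonneg_left hpt₁ (by positivity)
    have hA2 : (μ + α) * (θ₀ * r ^ 2) = μ / 2 * r ^ 2 := by rw [← mul_assoc, hθ₀key]
    have hm₁ge : m₁ = r ^ 2 - p t₁ := by linarith only [hpm]
    rw [hm₁ge]
    linarith only [hA1, hA2]
  have hquad : (1 - 2 * γ) * (μ / 2 * r ^ 2) ≤ (2 * γ - 1) * ⟪A (ζ t₁), ζ t₁⟫ := by
    have h1 : (1 - 2 * γ) * (μ / 2 * r ^ 2) ≤ (1 - 2 * γ) * (μ * m₁ - α * p t₁) :=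
      mul_le_mul_of_nonneg_left hlin1 h12.le
    have h2 : (1 - 2 * γ) * (μ * m₁ - α * p t₁) ≤ (1 - 2 * γ) * (-⟪A (ζ t₁), ζ t₁⟫) :=
      mul_le_mul_of_nonneg_left (by linarith only [hAζ]) h12.le
    linarith only [h1, h2]
  have hH' : Hb z + (1 / 2 * ((2 * γ - 1) * ⟪A (ζ t₁), ζ t₁⟫) - ν * r ^ 2) ≤ Hb (Y t₁) := hH
  have e : ν * r ^ 2 = (1 - 2 * γ) * μ * r ^ 2 / 8 := by rw [hν]; ring
  have hpos : 0 < (1 - 2 * γ) * μ * r ^ 2 / 8 := by positivity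
  linarith only [hH', e, hpos, hHlt, hquad]

/-! ### The theorems -/

/-- **NONDEGENERATE BAD NODES ⇒ TRIVIAL (arbitrary nodal set).**  Let `0 < γ < ½` and let `(U, P)` be a
`C²` self-similar Euler profile (CIV (3.3)) with the far-field bounds (3.8).  If at every NON-VORTICAL
stagnation point `z` (`V(z) = 0`, `curl U(z) = 0`) carrying a stretching rate `≥ 1` (a unit `w` with
`⟪DU(z)w, w⟫ ≥ 1`) the linearisation `DV(z) = γI + DU(z)` is injective — i.e. `−γ` is not an
eigenvalue of the strain `DU(z)` — then `U ≡ 0`.  No hypothesis on the nodal set (finite, countable or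
not).  Proof: `exists_topBadNode_of_ne_zero` + `false_of_topBadNode_of_injective`.
[cite: ConstantinIgnatovaVicol2026Putative, §3.5 Thm 3.10 (nodal hypotheses replaced by nondegeneracy of bad non-vortical nodes; not in print)] -/
theorem eq_zero_of_badNodes_nondegenerate (h : IsSelfSimilarEulerProfile γ c U P) (hγ : 0 < γ)
    (hγ2 : γ < 1 / 2) (hfar : HasSelfSimilarFarFieldWith γ c C U)
    (hnd : ∀ z ∈ selfSimilarNodalSet γ c U, curl U z = 0 →
      (∃ w : EuclideanSpace ℝ (Fin 3), ‖w‖ = 1 ∧ 1 ≤ ⟪fderiv ℝ U z w, w⟫) →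
      ∀ v, fderiv ℝ (selfSimilarTransport γ c U) z v = 0 → v = 0) :
    U = 0 := by
  by_contra hU
  obtain ⟨z, hzN, hbad, hcl, -, hconf, hΩz⟩ := exists_topBadNode_of_ne_zero h hγ hγ2 hfar hU
  exact false_of_topBadNode_of_injective h hγ hγ2 hfar hzN hΩz hbad hcl hconf (hnd z hzN hΩz hbad)

/-- **SURVIVOR PORTRAIT: the degenerate top bad node.**  Let `0 < γ < ½` and let `(U, P)` be a
NONTRIVIAL `C²` self-similar Euler profile with (3.8).  Then there is a stagnation point `z♭` which is
non-vortical (`curl U(z♭) = 0`), bad (`⟪DU(z♭)w, w⟫ ≥ 1` for a unit `w`), adherent to the vortical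
region (`z♭ ∈ closure{curl U ≠ 0}`), dominates it in Bernoulli value (`ℋ < ℋ(z♭)` on `{curl U ≠ 0}`),
and is DEGENERATE: `DU(z♭)v = −γ v` for some `v ≠ 0` (with `tr DU = 0` and the symmetric strain,
`spec DU(z♭) = {s, −γ, γ − s}`, `s ≥ 1` — the resonance of a stagnation curve through `z♭`).
[cite: ConstantinIgnatovaVicol2026Putative, §3.5 Thms 3.8–3.10, §4 (stagnation circles) (portrait not in print)] -/
theorem exists_degenerate_topBadNode_of_ne_zero (h : IsSelfSimilarEulerProfile γ c U P) (hγ : 0 < γ)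
    (hγ2 : γ < 1 / 2) (hfar : HasSelfSimilarFarFieldWith γ c C U) (hU : U ≠ 0) :
    ∃ z ∈ selfSimilarNodalSet γ c U, curl U z = 0 ∧
      (∃ w : EuclideanSpace ℝ (Fin 3), ‖w‖ = 1 ∧ 1 ≤ ⟪fderiv ℝ U z w, w⟫) ∧
      z ∈ closure {y | curl U y ≠ 0} ∧
      (∀ x, curl U x ≠ 0 → selfSimilarBernoulli γ c U P x < selfSimilarBernoulli γ c U P z) ∧
      ∃ v : EuclideanSpace ℝ (Fin 3), v ≠ 0 ∧ fderiv ℝ U z v = (-γ) • v := by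
  obtain ⟨z, hzN, hbad, hcl, -, hconf, hΩz⟩ := exists_topBadNode_of_ne_zero h hγ hγ2 hfar hU
  refine ⟨z, hzN, hΩz, hbad, hcl, hconf, ?_⟩
  by_contra hnone
  push Not at hnone
  refine false_of_topBadNode_of_injective h hγ hγ2 hfar hzN hΩz hbad hcl hconf fun v hv => ?_
  by_contra hv0
  refine hnone v hv0 ?_
  rw [fderiv_transport_eq h z] at hv
  have e : fderiv ℝ U z v = -(γ • v) := by
    have : γ • v + fderiv ℝ U z v = 0 := by
      simpa [add_apply] using hv
    exact eq_neg_of_add_eq_zero_right this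
  rw [e, neg_smul]

/-- **Exponent form** (route EulerZoomLiouville: `γ = 1/(2+ρ)`, window `ρ > 0`): nondegenerate bad
non-vortical nodes ⇒ trivial. [cite: ConstantinIgnatovaVicol2026Putative, §3.5 Thm 3.10 (nodal hypotheses replaced by nondegeneracy of bad non-vortical nodes; not in print)] -/
theorem eq_zero_of_badNodes_nondegenerate_of_exponent {ρ : ℝ} (hρ : 0 < ρ)
    (h : IsSelfSimilarEulerProfile (1 / (2 + ρ)) c U P)
    (hfar : HasSelfSimilarFarFieldWith (1 / (2 + ρ)) c C U)
    (hnd : ∀ z ∈ selfSimilarNodalSet (1 / (2 + ρ)) c U, curl U z = 0 →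
      (∃ w : EuclideanSpace ℝ (Fin 3), ‖w‖ = 1 ∧ 1 ≤ ⟪fderiv ℝ U z w, w⟫) →
      ∀ v, fderiv ℝ (selfSimilarTransport (1 / (2 + ρ)) c U) z v = 0 → v = 0) :
    U = 0 := by
  have hγ : 0 < 1 / (2 + ρ) := by positivity
  have hγ2 : 1 / (2 + ρ) < 1 / 2 := by
    rw [div_lt_div_iff₀ (by positivity) (by positivity)]; linarith
  exact eq_zero_of_badNodes_nondegenerate h hγ hγ2 hfar hnd

end Summit.NavierStokesRegularity.NavierStokesRegularity.Theorems.PowerGaugeEulerLiouville.NodalContinuum
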